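import Literature.NumberTheory.EllipticCurves.NeronModelExistence
import Literature.AlgebraicGeometry.Motives.AbelianVariety
import Literature.AnabelianGeometry.AbsoluteAnabelian.AbsTopIII.KummerFaithful
import HarnessLib

/-!
# [AbsTopIII] Rmk. 1.5.4 (i), "restricting to closed points": divisible points become divisible sections of the Néron model

Proof-only companion (no new definitions) to `AbsTopIII/KummerFaithful.lean` (S. Mochizuki, *Topics in
Absolute Anabelian Geometry III*, §1, Def. 1.5 (a) p. 32, Rmk. 1.5.4 (i) p. 33, lit key
`paper:url-5493eb38cbb7`).  Junction J-c (first half) of the route of record for the last open part of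
FACT-LIST row F-0369 (HOME/staging/f/f-083/g2/F0369-FG-ROUTE.md): let `R` be a Dedekind domain with
fraction field `L`, `A` an abelian variety over `L` and `𝒩 → Spec R` a group scheme which is a NÉRON
MODEL of `A` (tree `Literature.NumberTheory.EllipticCurves.IsNeronModel`; e.g. the proper smooth group
scheme of `exists_abelianScheme_away_holds` over `R[1/f]`, by `isNeronModel_of_isProper_of_smooth`).
The Néron mapping property at `𝒳 = Spec R` says that restriction to the generic fibre is a bijection
`𝒩(R) → A(L)` from global sections onto rational points; it is a GROUP ISOMORPHISM (the generic-fibre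
functor is monoidal: Mathlib `Functor.map_mul`; the identifications `Spec L ≅ (Spec R)_L` and
`𝒩_L ≅ A` are compatible with the group laws).  Consequently:

* `IsNeronModel.sectionsToPoints_bijective` — the map
  `s ↦ (Spec L = 𝟙 ≅ (Spec R)_L) ≫ s_L ≫ (𝒩_L ≅ A)` is a bijection `𝒩(R) → A(L)`;
  `sectionsToPoints_mul`, `sectionsToPoints_one` — it is multiplicative;
* `IsNeronModel.divisibleElementsTrivial_points_of_sections` — **if every infinitely divisible global
  section of `𝒩` is the unit section, then `⋂_N N · A(L) = {0}`** (condition (a) of Def. 1.5 for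
  `A(L)`): a divisible point lifts, with all its roots, to a divisible section.

This is the step "`x ∈ A(k)` […] restricting to various closed points" (p. 33) in which the point `x`
of the abelian variety over the function field is replaced by a section of a model over the curve, to
which reduction at closed points applies (companions `KummerFaithfulDedekindSectionsProofs`,
`KummerFaithfulProperGroupSchemePointsProofs`).  Nothing here bears on [IUTchIII] Cor. 3.12; typed ≠
discharged.
-/

noncomputable section

open _root_.CategoryTheory _root_.AlgebraicGeometry
open scoped _root_.CategoryTheory.MonObj _root_.CategoryTheory.Obj MonoidalCategory Classical

namespace Literature.AnabelianGeometry.AbsoluteAnabelian.AbsTopIII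

universe u

open Literature.AlgebraicGeometry.Motives Literature.NumberTheory.EllipticCurves

variable {R : Type u} [CommRing R] {L : Type u} [Field L] [Algebra R L]

/-- `Spec L` over itself (the tree's `specOver L L`, source of `L`-points) is the unit object of
`Over (Spec L)` (both are `Spec L` with the identity structure map; `algebraMap L L = id`). Routine.
[cite: MochizukiAbsTopIII2015, Rmk 1.5.4 (i) p.33] -/
theorem specOver_self_eq_tensorUnit (L : Type u) [Field L] :
    specOver L L = 𝟙_ (Over (Spec (.of L))) := by
  change Over.mk (Spec.map (CommRingCat.ofHom (algebraMap L L))) = Over.mk (𝟙 (Spec (.of L)))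
  rw [Algebra.algebraMap_self, CommRingCat.ofHom_id, Spec.map_id]

namespace IsNeronModel

variable (A : AbelianVariety L) {𝒩 : Over (Spec (.of R))} [GrpObj 𝒩]

/-- The sections-to-points map is multiplicative: restriction to the generic fibre is
`Functor.map` of a monoidal functor (Mathlib `Functor.map_mul`), precomposition with a fixed
morphism is multiplicative (`MonObj.comp_mul`) and postcomposition with the group isomorphism
`𝒩_L ≅ A` is multiplicative (`MonObj.mul_comp`). [cite: MochizukiAbsTopIII2015, Rmk 1.5.4 (i) p.33] -/
theorem sectionsToPoints_mul (h : IsNeronModel R L 𝒩 A.X) (s t : 𝟙_ (Over (Spec (.of R))) ⟶ 𝒩) :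
    (eqToHom (specOver_self_eq_tensorUnit L) ≫ (Functor.Monoidal.εIso (genericFibre R L)).hom ≫
        (genericFibre R L).map (s * t) ≫ h.exists_iso.choose.hom : A.Points L) =
      (eqToHom (specOver_self_eq_tensorUnit L) ≫ (Functor.Monoidal.εIso (genericFibre R L)).hom ≫
          (genericFibre R L).map s ≫ h.exists_iso.choose.hom) *
        (eqToHom (specOver_self_eq_tensorUnit L) ≫ (Functor.Monoidal.εIso (genericFibre R L)).hom ≫
          (genericFibre R L).map t ≫ h.exists_iso.choose.hom) := by
  haveI : IsMonHom h.exists_iso.choose.hom := h.exists_iso.choose_spec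
  rw [Functor.map_mul, MonObj.mul_comp, MonObj.comp_mul, MonObj.comp_mul]

/-- The sections-to-points map sends the unit section to the identity of `A(L)`
(`Functor.map_one`, `MonObj.comp_one`, `MonObj.one_comp`). [cite: MochizukiAbsTopIII2015, Rmk 1.5.4 (i) p.33] -/
theorem sectionsToPoints_one (h : IsNeronModel R L 𝒩 A.X) :
    (eqToHom (specOver_self_eq_tensorUnit L) ≫ (Functor.Monoidal.εIso (genericFibre R L)).hom ≫
        (genericFibre R L).map (1 : 𝟙_ (Over (Spec (.of R))) ⟶ 𝒩) ≫ h.exists_iso.choose.hom :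
          A.Points L) = 1 := by
  haveI : IsMonHom h.exists_iso.choose.hom := h.exists_iso.choose_spec
  rw [Functor.map_one, MonObj.one_comp, MonObj.comp_one, MonObj.comp_one]

/-- **The sections-to-points map is a bijection `𝒩(R) → A(L)`** — the Néron mapping property at
`𝒳 = Spec R` (`IsNeronModel.mappingProperty_tensorUnit`), the other three constituents being
isomorphisms (Liu, §10.2.2 p. 499: "the canonical map `𝒩(S) → E(K)` is bijective").
[cite: MochizukiAbsTopIII2015, Rmk 1.5.4 (i) p.33] -/
theorem sectionsToPoints_bijective (h : IsNeronModel R L 𝒩 A.X) :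
    Function.Bijective fun s : 𝟙_ (Over (Spec (.of R))) ⟶ 𝒩 =>
      (eqToHom (specOver_self_eq_tensorUnit L) ≫ (Functor.Monoidal.εIso (genericFibre R L)).hom ≫
        (genericFibre R L).map s ≫ h.exists_iso.choose.hom : A.Points L) := by
  have h1 : Function.Bijective fun s : 𝟙_ (Over (Spec (.of R))) ⟶ 𝒩 => (genericFibre R L).map s :=
    h.mappingProperty_tensorUnit
  refine ⟨fun s t hst => h1.1 ?_, fun x => ?_⟩
  · -- cancel the three isomorphisms
    have hst' : eqToHom (specOver_self_eq_tensorUnit L) ≫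
        (Functor.Monoidal.εIso (genericFibre R L)).hom ≫ (genericFibre R L).map s ≫
          h.exists_iso.choose.hom =
        eqToHom (specOver_self_eq_tensorUnit L) ≫
          (Functor.Monoidal.εIso (genericFibre R L)).hom ≫ (genericFibre R L).map t ≫
            h.exists_iso.choose.hom := hst
    rw [cancel_epi, cancel_epi, cancel_mono] at hst'
    exact hst'
  · obtain ⟨s, hs⟩ := h1.2 ((Functor.Monoidal.εIso (genericFibre R L)).inv ≫
      eqToHom (specOver_self_eq_tensorUnit L).symm ≫ x ≫ h.exists_iso.choose.inv)
    refine ⟨s, ?_⟩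
    have hs' : (genericFibre R L).map s = (Functor.Monoidal.εIso (genericFibre R L)).inv ≫
        eqToHom (specOver_self_eq_tensorUnit L).symm ≫ x ≫ h.exists_iso.choose.inv := hs
    simp only [hs', Category.assoc, Iso.hom_inv_id_assoc, eqToHom_trans_assoc, eqToHom_refl,
      Category.id_comp, Iso.inv_hom_id, Category.comp_id]

/-- **A divisible point of `A(L)` lifts to a divisible global section of the Néron model, so
condition (a) of [AbsTopIII] Def. 1.5 for `A(L)` follows from its analogue for sections**: if every
global section `s` of `𝒩` admitting an `n`-th root for every `n ≥ 1` is the unit section, then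
`⋂_{N ≥ 1} N · A(L) = {0}` (Rmk. 1.5.4 (i) p. 33: the point of the abelian variety over the function
field is studied through the model over the curve). [cite: MochizukiAbsTopIII2015, Rmk 1.5.4 (i) p.33] -/
theorem divisibleElementsTrivial_points_of_sections (h : IsNeronModel R L 𝒩 A.X)
    (hs : ∀ s : 𝟙_ (Over (Spec (.of R))) ⟶ 𝒩,
      (∀ n : ℕ, 0 < n → ∃ t : 𝟙_ (Over (Spec (.of R))) ⟶ 𝒩, t ^ n = s) → s = 1) :
    DivisibleElementsTrivial (A.Points L) := by
  -- the sections-to-points map `Φ`, a multiplicative bijection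
  set Φ : (𝟙_ (Over (Spec (.of R))) ⟶ 𝒩) → A.Points L := fun s =>
    eqToHom (specOver_self_eq_tensorUnit L) ≫ (Functor.Monoidal.εIso (genericFibre R L)).hom ≫
      (genericFibre R L).map s ≫ h.exists_iso.choose.hom with hΦ
  have hbij : Function.Bijective Φ := sectionsToPoints_bijective A h
  have hmul : ∀ s t, Φ (s * t) = Φ s * Φ t := fun s t => sectionsToPoints_mul A h s t
  have hone : Φ 1 = 1 := sectionsToPoints_one A h
  have hpow : ∀ (s) (n : ℕ), Φ (s ^ n) = Φ s ^ n := by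
    intro s n
    induction n with
    | zero => simp [hone]
    | succ n ih => rw [pow_succ, hmul, ih, pow_succ]
  refine ⟨fun x hx => ?_⟩
  obtain ⟨s, rfl⟩ := hbij.2 x
  have hsd : ∀ n : ℕ, 0 < n → ∃ t : 𝟙_ (Over (Spec (.of R))) ⟶ 𝒩, t ^ n = s := by
    intro n hn
    obtain ⟨y, hy⟩ := hx n hn
    obtain ⟨t, rfl⟩ := hbij.2 y
    exact ⟨t, hbij.1 (by rw [hpow, hy])⟩
  rw [hs s hsd, hone]

end IsNeronModel

end Literature.AnabelianGeometry.AbsoluteAnabelian.AbsTopIII
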